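import Literature.Geometry.GeometricMeasureTheory.CurrentsWeakCompactness
import Literature.Geometry.GeometricMeasureTheory.CurrentsNullSupport

/-!
# The Federer–Fleming compactness statement in its degenerate regimes

`Literature.Geometry.GeometricMeasureTheory.Federer1969_compactness_integralCurrents` (Federer
4.2.17 (2), corollary form) asserts: every sequence of integral `(m+1)`-currents in a
finite-dimensional inner product space `V`, supported in `𝐁(x₀, ρ)` with `𝐍 ≤ c < ∞`, has a
subsequence converging in the integral flat norm to an integral current with the same bounds.
Here we prove the statement in the three regimes in which every term of the sequence is forced to
vanish, so that `T' = 0` works: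

* `…_of_finrank_le` — `dim V ≤ m`: `𝓗^{m+1} = 0` on `V`, so every locally rectifiable
  `(m+1)`-current is zero (`Current.IsLocallyRectifiable.eq_zero_of_finrank_lt`);
* `…_of_c_eq_zero` — `c = 0`: `𝐌(Tᵢ) = 0` forces `Tᵢ = 0` (`Current.eq_zero_of_mass_eq_zero`);
* `…_of_lt_zero` — `ρ < 0`: `spt Tᵢ = ∅` forces `Tᵢ = 0` (`Current.eq_zero_of_support_eq_empty`,
  smooth partitions of unity).

The general case is the deep theorem (deformation theorem 4.2.9 and closure theorem 4.2.16) and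
is not proved here; `Federer1969_compactness_of_closure_of_flatLimit` records the exact reduction:
the statement follows from the weak form (`Federer1969_compactness_weakForm` of
`CurrentsWeakCompactness.lean`: subsequence, weak limit with `spt ⊆ 𝐁(x₀, ρ)`, `𝐍 ≤ c`) once one
knows (H1) weak limits of `𝐍`-bounded integral currents supported in a compact set are integral
(the closure theorem 4.2.16 (1)) and (H2) such weak convergence to an integral current implies
convergence in the integral flat norm (the content of 4.2.17 via the deformation theorem 4.2.9).

Source: H. Federer, *Geometric Measure Theory*, Springer 1969 (`Federer1969`), 4.2.17 (2).
-/

open scoped Distributions ENNReal NNReal Topology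
open MeasureTheory TopologicalSpace Set Filter

namespace Literature.Geometry.GeometricMeasureTheory

set_option maxSynthPendingDepth 2

universe u

variable {V : Type u} [NormedAddCommGroup V] [InnerProductSpace ℝ V] [FiniteDimensional ℝ V]
  [MeasurableSpace V] [BorelSpace V] {m : ℕ}

omit [FiniteDimensional ℝ V] in
/-- The conclusion of the compactness statement holds trivially for the zero sequence, with
`T' = 0` and the identity subsequence. [cite: Federer1969, 4.2.17 (2)] -/
theorem compactness_conclusion_of_forall_eq_zero (x₀ : V) (ρ : ℝ) (c : ℝ≥0∞)
    (T : ℕ → Current (⊤ : Opens V) (m + 1)) (hT : ∀ i, T i = 0) :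
    ∃ (T' : Current (⊤ : Opens V) (m + 1)) (ι : ℕ → ℕ), StrictMono ι ∧ T'.IsIntegral ∧
      T'.support ⊆ Metric.closedBall x₀ ρ ∧ T'.normalMass ≤ c ∧
      Tendsto (fun j => (T (ι j) - T').integralFlatNorm) atTop (𝓝 0) := by
  refine ⟨0, id, strictMono_id, Current.isIntegral_zero, by simp, ?_, ?_⟩
  · simp [Current.normalMass]
  · have : (fun j => (T (id j) - 0).integralFlatNorm) = fun _ => 0 := by
      funext j
      rw [sub_zero, id, hT j, Current.integralFlatNorm_zero]
    rw [this]
    exact tendsto_const_nhds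

/-- **Compactness statement in codimension `< 0`**: if `dim V ≤ m` then every integral
`(m+1)`-current in `V` vanishes, and the conclusion of
`Federer1969_compactness_integralCurrents` holds with `T' = 0`. [cite: Federer1969, 4.2.17 (2)] -/
theorem Federer1969_compactness_integralCurrents_of_finrank_le (hV : Module.finrank ℝ V ≤ m)
    (x₀ : V) (ρ : ℝ) (c : ℝ≥0∞) (T : ℕ → Current (⊤ : Opens V) (m + 1))
    (hT : ∀ i, (T i).IsIntegral ∧ (T i).support ⊆ Metric.closedBall x₀ ρ ∧ (T i).normalMass ≤ c) :
    ∃ (T' : Current (⊤ : Opens V) (m + 1)) (ι : ℕ → ℕ), StrictMono ι ∧ T'.IsIntegral ∧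
      T'.support ⊆ Metric.closedBall x₀ ρ ∧ T'.normalMass ≤ c ∧
      Tendsto (fun j => (T (ι j) - T').integralFlatNorm) atTop (𝓝 0) :=
  compactness_conclusion_of_forall_eq_zero x₀ ρ c T fun i =>
    (hT i).1.1.1.eq_zero_of_finrank_lt (by omega)

omit [FiniteDimensional ℝ V] in
/-- **Compactness statement for `c = 0`**: `𝐍(Tᵢ) ≤ 0` forces `𝐌(Tᵢ) = 0`, hence `Tᵢ = 0`.
[cite: Federer1969, 4.2.17 (2)] -/
theorem Federer1969_compactness_integralCurrents_of_c_eq_zero (x₀ : V) (ρ : ℝ)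
    (T : ℕ → Current (⊤ : Opens V) (m + 1))
    (hT : ∀ i, (T i).IsIntegral ∧ (T i).support ⊆ Metric.closedBall x₀ ρ ∧ (T i).normalMass ≤ 0) :
    ∃ (T' : Current (⊤ : Opens V) (m + 1)) (ι : ℕ → ℕ), StrictMono ι ∧ T'.IsIntegral ∧
      T'.support ⊆ Metric.closedBall x₀ ρ ∧ T'.normalMass ≤ 0 ∧
      Tendsto (fun j => (T (ι j) - T').integralFlatNorm) atTop (𝓝 0) :=
  compactness_conclusion_of_forall_eq_zero x₀ ρ 0 T fun i =>
    (T i).eq_zero_of_mass_eq_zero (nonpos_iff_eq_zero.1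
      ((self_le_add_right _ _).trans (hT i).2.2))

/-- **Compactness statement for `ρ < 0`**: the ball `𝐁(x₀, ρ)` is empty, so `spt Tᵢ = ∅` and
`Tᵢ = 0`. [cite: Federer1969, 4.2.17 (2)] -/
theorem Federer1969_compactness_integralCurrents_of_lt_zero (x₀ : V) {ρ : ℝ} (hρ : ρ < 0)
    (c : ℝ≥0∞) (T : ℕ → Current (⊤ : Opens V) (m + 1))
    (hT : ∀ i, (T i).IsIntegral ∧ (T i).support ⊆ Metric.closedBall x₀ ρ ∧ (T i).normalMass ≤ c) :
    ∃ (T' : Current (⊤ : Opens V) (m + 1)) (ι : ℕ → ℕ), StrictMono ι ∧ T'.IsIntegral ∧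
      T'.support ⊆ Metric.closedBall x₀ ρ ∧ T'.normalMass ≤ c ∧
      Tendsto (fun j => (T (ι j) - T').integralFlatNorm) atTop (𝓝 0) :=
  compactness_conclusion_of_forall_eq_zero x₀ ρ c T fun i =>
    (T i).eq_zero_of_support_eq_empty (subset_empty_iff.1
      ((hT i).2.1.trans (by rw [Metric.closedBall_eq_empty.2 hρ])))

/-- **Reduction of the compactness statement to the closure theorem and the flat-limit property.**
`Federer1969_compactness_integralCurrents` follows from the weak form of the statement
(`Federer1969_compactness_weakForm`: weak sequential compactness of `𝐍`-bounded currents, lower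
semicontinuity of `𝐍`, supports of weak limits) and two properties of integral currents on
finite-dimensional inner product spaces, taken here as HYPOTHESES (they are Federer's closure
theorem 4.2.16 (1) and the flat-convergence half of 4.2.17, both resting on the deformation theorem
4.2.9, and are not proved in this tree): (H1) a weak limit of integral currents with supports in a
compact `K` and `𝐍 ≤ c < ∞` is integral; (H2) for such a sequence, weak convergence to an integral
current implies convergence in the integral flat norm (both clauses for `c < ∞` only: for `c = ∞`
each would be false). [cite: Federer1969, 4.2.17 (2), 4.2.16 (1)] -/
theorem Federer1969_compactness_of_closure_of_flatLimit
    (hclosure : ∀ (V : Type u) [NormedAddCommGroup V] [InnerProductSpace ℝ V]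
      [FiniteDimensional ℝ V] [MeasurableSpace V] [BorelSpace V] (m : ℕ) (K : Set V),
      IsCompact K → ∀ (c : ℝ≥0∞), c ≠ ⊤ → ∀ (T : ℕ → Current (⊤ : Opens V) (m + 1))
        (T' : Current (⊤ : Opens V) (m + 1)),
        (∀ i, (T i).IsIntegral ∧ (T i).support ⊆ K ∧ (T i).normalMass ≤ c) →
        (∀ φ, Tendsto (fun i => T i φ) atTop (𝓝 (T' φ))) → T'.IsIntegral)
    (hflat : ∀ (V : Type u) [NormedAddCommGroup V] [InnerProductSpace ℝ V]
      [FiniteDimensional ℝ V] [MeasurableSpace V] [BorelSpace V] (m : ℕ) (K : Set V),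
      IsCompact K → ∀ (c : ℝ≥0∞), c ≠ ⊤ → ∀ (T : ℕ → Current (⊤ : Opens V) (m + 1))
        (T' : Current (⊤ : Opens V) (m + 1)),
        (∀ i, (T i).IsIntegral ∧ (T i).support ⊆ K ∧ (T i).normalMass ≤ c) → T'.IsIntegral →
        (∀ φ, Tendsto (fun i => T i φ) atTop (𝓝 (T' φ))) →
        Tendsto (fun i => (T i - T').integralFlatNorm) atTop (𝓝 0)) :
    Federer1969_compactness_integralCurrents.{u} := by
  intro V _ _ _ _ _ m x₀ ρ c hc T hT
  obtain ⟨T', ι, hι, hspt, hN, hw, -⟩ :=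
    Federer1969_compactness_weakForm x₀ ρ c hc T fun i => ⟨(hT i).2.1, (hT i).2.2⟩
  have hsub : ∀ j, (T (ι j)).IsIntegral ∧ (T (ι j)).support ⊆ Metric.closedBall x₀ ρ ∧
      (T (ι j)).normalMass ≤ c := fun j => hT (ι j)
  have hint : T'.IsIntegral :=
    hclosure V m _ (isCompact_closedBall x₀ ρ) c hc (fun j => T (ι j)) T' hsub hw
  exact ⟨T', ι, hι, hint, hspt, hN,
    hflat V m _ (isCompact_closedBall x₀ ρ) c hc (fun j => T (ι j)) T' hsub hint hw⟩

end Literature.Geometry.GeometricMeasureTheory
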